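import Summits.QuantumFields.YangMills.Theorems.BalabanUVNodesN11AFibreDominationOfCoercive
import Summits.QuantumFields.YangMills.Theorems.BalabanUVNodesN11TkBranchWeightCongr

/-!
# DAG node N11 — THE A-FIBRE DOMINATION ∕ COERCIVITY ROW OF THE NO-EXPANSION 𝐓-STEP ASKED ONLY ON THE SUPPORT OF `ζ_j`:
# the old branches `U₀ ↦ 𝐓_k(s,S)[Φ](base_k U₀)` are `dU_k`-integrable as soon as each generation's A-fibre weight is dominated ON THE A-FIBRES THROUGH
# `supp ζ_j(Ω^c_{j+1})` — so [I]'s positivity of `𝒬_j` (coercivity of the residual's `quad`) is asked only where print asks it: behind `ζ(Ω^c_{j+1})`,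
# i.e. at backgrounds regular on the reading region ([III] p.256), never at irregular ones

HEADER — WORK-UNIT METADATA.  Cell `pub-ymgap`, YM-PLAN Track A (HUMAN RULING D-0062 ∕ D-0149), WIDTH SEAT `pub-ymgap-dag-n11-w4` (g2; harness re-seat of g0) on
NODE n11 [B14]; route `BalabanUVNodes` rev 25, item K1⁷ `StabilityBAtRecordR13SepCoPH` = stmt-QuantumFields-20542 (helper, `--kind proof --supports 20542 --as helper`,
count-neutral).  This base's g0 replaced the K0b A-fibre DOMINATION binder of dag-n11-d's door (d3) (`…N11TkBranchMassBound` §5, p580601 §2) by ONE pointwise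
COERCIVITY row on the VALUE of the residual's `quad` (`…N11AFibreDominationOfCoercive`) — asked at EVERY configuration.  Referee ref-M g2 READ-15∕30 (T2∕T3∕A2):
that row forces `quad_j ≥ 0` EVERYWHERE and is strictly stronger than nonnegativity on a nonempty fibre.  Print never asks so much: in (2.21) p.258 the Gaussian
`exp[−½⟨A_j, 𝒬_j A_j⟩]` stands behind `ζ(Ω^c_{j+1})`, and [I]'s positivity of `𝒬_j` ((2.11) p.267 of [I]) is a statement at backgrounds regular on the reading
region — p.256 «we assume that the field V_{j−1} is regular on Γ_{j−1}» — which a non-zero `ζ` certifies (node00-def-T's displayed law `TkResidualW.RegOn Γr`, 12a″ §3).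
THIS FILE (g0's TRIGGER (t4), bus l.26096) weakens the row accordingly, end to end, WITHOUT re-running C2's template induction.  [III] = [Balaban1988Convergent],
[I] = [Balaban1987RG1].

THE DEVICE.  `𝐓^{(j)} = vT ∘ ζ· ∘ ∫dA_j|_{sA} w_j·(·)` reads `w_j` only on the A-fibres `{ω[A_j|_{sA} := a]}` through configurations with `ζ_j(ω) ≠ 0` (§1), so the
guarded weight `𝟙[row holds]·χ_A` (measurable, in `[0,1]`) has the same branch operator and is dominated EVERYWHERE — dag-n11-d's C2 §5 applies to it verbatim (§2).

WHAT THIS FILE PROVES (0 `sorry`, 0 `def`; standard axioms).  §1 (generic 11a) `aOp_congr_of_eq_on_fibre`, ★ `genOp_congr_of_w_eq_on_support`.  §2 (generic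
C2 level) ★★ `integrable_tkBranchOfRecord_baseCfg_of_dominated_on_support` — C2 §5 with its row `∀ j ω, ofReal (w_j ω) ≤ ŵ_j(A_j ω|sA_j)` WEAKENED to «for every `ω`
with `ζ_j((Ω_{j+1})ᶜ)(ω) ≠ 0` and every `ω′` on the A-fibre of `ω` (same variables except `A_j` on `sA_j`), `ofReal (w_j ω′) ≤ ŵ_j(A_j ω′|sA_j)`».  §3 (generic 12a″
weights) ★★ `afibre_dominated_on_support_of_coercive_on_support` (coercivity of `Z.quad j Λ′` on the A-fibres through `supp Z.ζ0 j Y₀` ⇒ the §2 row, g0's Gaussian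
majorant) and ★★ `afibre_dominated_on_support_of_coercive_on_regular` (guard = ANY predicate `Reg` of the scale-`j` GAUGE component `(ω j).1` forced by `ζ0 ≠ 0` —
def-T's `RegOn` consequent shape; A-updates keep `(ω j).1`).  §4 (v1.7 `CoPH` record, GENERIC `θ`) ★★★ `integrable_oldBranch_of_coercive_on_support`,
★★★ `integrable_oldBranch_of_coercive_on_regular`, ★★★ `integrable_oldBranch_of_regOn_of_coercive_on_reading` — g0 §4 ∕ p580601 §2 with the coercivity row asked
only on `supp ζ0_j((Ω_{j+1})ᶜ)(init s′)`, resp. at `Reg_j`-backgrounds, resp. at backgrounds `(cR·ε_j)`-regular on the reading region `Γr j (Ω_{j+1})ᶜ`.  §5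
`coercive_on_support_of_coercive` (g0's everywhere row ⇒ the refined row; A2) and the BRIDGES `coercive_on_support_of_coercive_on_regular`,
`coercive_on_support_of_regOn_of_coercive_on_reading` (print-shaped pair ⇒ §4's row, per history).  STRICTNESS ∕ A6 exhibit: sibling `…OnSupportModel`.

HONEST FRAMING.  Helper lane of K1⁷; measure-theoretic bookkeeping over accepted tree objects; [I]'s positivity of `𝒬_j` is a DISPLAYED row (now displayed on the set
where print displays it), NOT asserted; no law of record is edited or posited; dag-n11-d's C2 and 11a∕12a″ are consumed BY NAME.  N11 NOT discharged; K1⁷ NOT closed;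
counts unmoved (typed 28∕28 · discharged 5∕27).  One finite four-torus programme at fixed `ε = L^{−K}`; R4 closes only the conditional finite-𝕋⁴ rung
`BalabanLadder.UV` — NOT ℝ⁴, NOT OS, NOT a mass gap, NOT Clay.  No `sorry`, `axiom`, `def`, `instance`, `notation`.
Sources (SHAPE only): [III] (2.18) p.257, (2.20)–(2.22) p.258, (2.10) p.256, (3.21) p.269, (3.23)–(3.24) p.270; [I] (2.11) p.267 (shape of the coercivity row).
-/

noncomputable section

open MeasureTheory
open scoped BigOperators ENNReal NNReal

namespace Summit.QuantumFields.YangMills.Theorems.BalabanUVNodesN11AFibreDominationOnSupport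

open Literature.MathematicalPhysics.QuantumFieldTheory.Balaban1983to89 T4Continuum T4NestedCovariance T4AdjointCovariance Node00 Node00.Tk
open B15DeterminingSets (MSField)
open B10Eq42TorusConstraint (bondsIn)
open BalabanUVNodesN11TkBranchMassBound (integrable_tkBranchOfRecord_baseCfg_of_dominated)
open BalabanUVNodesN11TkBranchWeightCongr (tkOp_congr_of_lt)
open BalabanUVNodesN11AFibreDominationOfCoercive (measurable_gaussMajorant lintegral_gaussMajorant_ne_top exp_neg_half_le_gaussMajorant)
open BalabanUVNodesN11OldBranchIntegrableOfDominated (zhAt_ζ0_le_one_of_unity)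
open BalabanUVNodesN11DiagonalOldBranchMeasurable (measurable_WtOfRecord₁₃H_ζ measurable_WtOfRecord₁₃H_w)
open BalabanUVNodesN11NoExpansionDiagonalCoPH (WtOfRecord₁₃H_eq_tkWeightsOfRecordP)
open BalabanUVNodesN11NoExpansionDiagonalAtZ (tkWeightsOfRecordP_ζ_apply)
open B15DeterminingSets (pts)
open B8Eq17ClassAkV1 (plaqsOf)

universe u

/-! ## §1  Generic 11a: a generation reads its A-weight only on the A-fibres through `supp ζ` -/
section Generic

variable {P : Params} {G : Type u} {V : Type u}
variable [NormedAddCommGroup V] [InnerProductSpace ℝ V] [FiniteDimensional ℝ V] [MeasurableSpace V] [BorelSpace V]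

/-- **THE A-FACTOR READS ITS WEIGHT ON ONE A-FIBRE**: two weights agreeing on the A-fibre `{ω[A_j|_{sA} := a]}` through `ω` give the same value `(∫dA_j|_{sA} w·F)(ω)`.
[cite: Balaban1988Convergent, (2.21) p.258 (bookkeeping)] -/
theorem aOp_congr_of_eq_on_fibre (j : ℕ) [DecidableEq (PBond P j)] (sA : Finset (PBond P j)) {w w' : MultiCfg P G V → ℝ}
    (F : MultiCfg P G V → ℝ) (ω : MultiCfg P G V)
    (h : ∀ a : ↥sA → V, w' (Function.update ω j (insA sA a (ω j))) = w (Function.update ω j (insA sA a (ω j)))) :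
    aOp j sA w' F ω = aOp j sA w F ω := by
  simp only [aOp_apply, h]

/-- **★ ONE GENERATION READS ITS A-WEIGHT ONLY ON THE A-FIBRES THROUGH `supp ζ`**: in `𝐓^{(j)} = vT ∘ (ζ·) ∘ ∫dA_j|_{sA} w·(·)` ((2.21): the A-integral inside the
V-integral, behind the weight `ζ(Ω^c_{j+1})`), replacing the A-weight `w` by any `w′` that agrees with it on every A-fibre through a configuration with `ζ ≠ 0` does not
change the operation. [cite: Balaban1988Convergent, (2.21) p.258] -/
theorem genOp_congr_of_w_eq_on_support (j : ℕ) [DecidableEq (PBond P j)] (D : GenData P G V j) {w' : MultiCfg P G V → ℝ}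
    (h : ∀ (ω : MultiCfg P G V) (a : ↥D.sA → V), D.ζ ω ≠ 0 →
      w' (Function.update ω j (insA D.sA a (ω j))) = D.w (Function.update ω j (insA D.sA a (ω j)))) :
    genOp j { D with w := w' } = genOp j D := by
  funext F ω
  simp only [genOp_apply, vOp_apply, zetaOp_apply]
  congr 1
  funext y
  by_cases hζ : D.ζ (Function.update ω j (Function.updateFinset (ω j).1 D.sV y, (ω j).2)) = 0
  · rw [hζ, zero_mul, zero_mul]
  · rw [aOp_congr_of_eq_on_fibre j D.sA F _ (fun a => h _ a hζ)]

end Generic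

/-! ## §2  ★★ Generic C2 level: the old branches are integrable under A-fibre domination ON THE SUPPORT OF `ζ_j` (guarded weights) -/
section Support

variable {F : T4Family} {N : ℕ} [NeZero N] {V : Type} [NormedAddCommGroup V] [InnerProductSpace ℝ V] [FiniteDimensional ℝ V]
  [MeasurableSpace V] [BorelSpace V]
variable (ν : Stage7Numerics) (M : ℕ) (g : ℕ → ℝ) (K : ℕ) (W : TkWeights F N V K)

/-- **★★ THE OLD BRANCHES ARE `dU_k`-INTEGRABLE UNDER A-FIBRE DOMINATION ON THE SUPPORT OF `ζ_j`** — dag-n11-d's C2 §5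
`integrable_tkBranchOfRecord_baseCfg_of_dominated` with its domination row WEAKENED: instead of `∀ j ω, ofReal (w_j ω) ≤ ŵ_j(A_j ω|_{sA_j})` only
«for every `ω` with `ζ_j((Ω_{j+1})ᶜ)(ω) ≠ 0` and every `ω′` ON THE A-FIBRE OF `ω` (all variables equal except `A_j` on the A-bonds `sA_j = bondsIn j (Λᶜ_{j+1} ∩ Ω_{j+1})`),
`ofReal (w_j ω′) ≤ ŵ_j(A_j ω′|_{sA_j})`».  All other rows as in C2 (`ζ_j` measurable in `[0,1]`, `w_j ≥ 0` measurable, `∫⁻ ŵ_j ≤ Cw j`, `Φ` measurable with `0 ≤ Φ ≤ CΦ`).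
PROOF: the GUARDED weight datum `W′ = (ζ, quad, 𝟙[row holds at ω]·χ_A)` has measurable A-weights in `[0, w]`, is dominated EVERYWHERE, and — the guard being `1` on
every A-fibre through `supp ζ_j` — has the same generations (§1), hence the same branch operator (dag-n11-d (PC) `tkOp_congr_of_lt`); C2 §5 at `W′`.
[cite: Balaban1988Convergent, (2.18) p.257, (2.20)–(2.21) p.258, (3.23)–(3.24) p.270] -/
theorem integrable_tkBranchOfRecord_baseCfg_of_dominated_on_support {n : ℕ} (s : SeqOfRecord F ν M g K n) (S : ℕ → Set (Site (F.P K) 0))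
    (hζm : ∀ j, Measurable (W.ζ j (s.Ω (j + 1))ᶜ)) (hζ0 : ∀ j ω, 0 ≤ W.ζ j (s.Ω (j + 1))ᶜ ω) (hζ1 : ∀ j ω, W.ζ j (s.Ω (j + 1))ᶜ ω ≤ 1)
    (hwm : ∀ j, Measurable (W.w j (s.Λ (j + 1)) ((s.Λ (j + 1))ᶜ ∩ s.Ω (j + 1)) (S (j + 1))))
    (hw0 : ∀ j ω, 0 ≤ W.w j (s.Λ (j + 1)) ((s.Λ (j + 1))ᶜ ∩ s.Ω (j + 1)) (S (j + 1)) ω)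
    (ŵ : (j : ℕ) → (↥(Set.toFinite (bondsIn j ((s.Λ (j + 1))ᶜ ∩ s.Ω (j + 1)))).toFinset → V) → ℝ≥0∞) (hŵm : ∀ j, Measurable (ŵ j))
    (hdom : ∀ (j : ℕ) (ω ω' : MultiCfg (F.P K) (SU N) V), W.ζ j (s.Ω (j + 1))ᶜ ω ≠ 0 → (∀ i, i ≠ j → ω' i = ω i) → (ω' j).1 = (ω j).1 →
      (∀ b, b ∉ bondsIn j ((s.Λ (j + 1))ᶜ ∩ s.Ω (j + 1)) → (ω' j).2 b = (ω j).2 b) →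
      ENNReal.ofReal (W.w j (s.Λ (j + 1)) ((s.Λ (j + 1))ᶜ ∩ s.Ω (j + 1)) (S (j + 1)) ω') ≤
        ŵ j (fun b : ↥(Set.toFinite (bondsIn j ((s.Λ (j + 1))ᶜ ∩ s.Ω (j + 1)))).toFinset => (ω' j).2 b))
    (Cw : ℕ → ℝ≥0) (hCw : ∀ j, ∫⁻ a, ŵ j a ∂(Measure.pi fun _ : ↥(Set.toFinite (bondsIn j ((s.Λ (j + 1))ᶜ ∩ s.Ω (j + 1)))).toFinset => (volume : Measure V)) ≤ Cw j)
    {Φ : MultiCfg (F.P K) (SU N) V → ℝ} (hΦm : Measurable Φ) (hΦ0 : ∀ ω, 0 ≤ Φ ω) (CΦ : ℝ) (hΦle : ∀ ω, Φ ω ≤ CΦ) (k : ℕ) :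
    Integrable (fun U₀ : GaugeField (F.P K) k (SU N) => tkBranchOfRecord F N V ν M g K W s S k Φ (baseCfg k U₀)) (fieldMeasure (F.P K) k (SU N)) := by
  -- the guard sets: «the domination row holds at ω»
  let Gd : ℕ → Set (MultiCfg (F.P K) (SU N) V) := fun j =>
    {ω | ENNReal.ofReal (W.w j (s.Λ (j + 1)) ((s.Λ (j + 1))ᶜ ∩ s.Ω (j + 1)) (S (j + 1)) ω) ≤
      ŵ j (fun b : ↥(Set.toFinite (bondsIn j ((s.Λ (j + 1))ᶜ ∩ s.Ω (j + 1)))).toFinset => (ω j).2 b)}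
  have hproj : ∀ j, Measurable (fun ω : MultiCfg (F.P K) (SU N) V =>
      (fun b : ↥(Set.toFinite (bondsIn j ((s.Λ (j + 1))ᶜ ∩ s.Ω (j + 1)))).toFinset => (ω j).2 b)) := fun j =>
    measurable_pi_lambda _ fun b => (measurable_pi_apply (b : PBond (F.P K) j)).comp (measurable_snd.comp (measurable_pi_apply j))
  have hGd : ∀ j, MeasurableSet (Gd j) := fun j => measurableSet_le (hwm j).ennreal_ofReal ((hŵm j).comp (hproj j))
  -- the guarded weight datum
  let W' : TkWeights F N V K := ⟨W.ζ, W.quad, fun j Y S' => (Gd j).indicator (W.chiA j Y S')⟩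
  have hw' : ∀ (j : ℕ) (Λ' Y S' : Set (Site (F.P K) 0)), W'.w j Λ' Y S' = (Gd j).indicator (W.w j Λ' Y S') := by
    intro j Λ' Y S'
    funext ω
    show (Gd j).indicator (W.chiA j Y S') ω * Real.exp (-(1 / 2 : ℝ) * W.quad j Λ' ω) =
      (Gd j).indicator (fun ω => W.chiA j Y S' ω * Real.exp (-(1 / 2 : ℝ) * W.quad j Λ' ω)) ω
    exact (Set.indicator_mul_left (Gd j) (W.chiA j Y S') (fun ω => Real.exp (-(1 / 2 : ℝ) * W.quad j Λ' ω))).symm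
  have hwm' : ∀ j, Measurable (W'.w j (s.Λ (j + 1)) ((s.Λ (j + 1))ᶜ ∩ s.Ω (j + 1)) (S (j + 1))) := fun j => by
    rw [hw']
    exact (hwm j).indicator (hGd j)
  have hw0' : ∀ j ω, 0 ≤ W'.w j (s.Λ (j + 1)) ((s.Λ (j + 1))ᶜ ∩ s.Ω (j + 1)) (S (j + 1)) ω := fun j ω => by
    rw [hw']
    exact Set.indicator_nonneg (fun ω _ => hw0 j ω) ω
  -- the guarded weights are dominated EVERYWHERE
  have hdom' : ∀ j ω, ENNReal.ofReal (W'.w j (s.Λ (j + 1)) ((s.Λ (j + 1))ᶜ ∩ s.Ω (j + 1)) (S (j + 1)) ω) ≤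
      ŵ j (fun b : ↥(Set.toFinite (bondsIn j ((s.Λ (j + 1))ᶜ ∩ s.Ω (j + 1)))).toFinset => (ω j).2 b) := fun j ω => by
    rw [hw']
    by_cases hω : ω ∈ Gd j
    · rw [Set.indicator_of_mem hω]
      exact hω
    · rw [Set.indicator_of_notMem hω, ENNReal.ofReal_zero]
      exact bot_le
  -- the guarded weights have the SAME branch operator: the guard is `1` on the A-fibres through `supp ζ_j`
  have heq : tkBranchOfRecord F N V ν M g K W' s S k = tkBranchOfRecord F N V ν M g K W s S k := by
    unfold tkBranchOfRecord
    refine tkOp_congr_of_lt _ _ k fun j _ => ?_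
    -- 11a's generations carry the CLASSICAL `DecidableEq` on bonds: pin it as the local instance (as dag-n11-d's C2 does)
    letI hdecA : DecidableEq (PBond (F.P K) j) := fun a b => Classical.propDecidable (a = b)
    show genOp j (genDataOfRecord F N V ν M g K W' s S j) = genOp j (genDataOfRecord F N V ν M g K W s S j)
    refine genOp_congr_of_w_eq_on_support j (genDataOfRecord F N V ν M g K W s S j)
      (w' := W'.w j (s.Λ (j + 1)) ((s.Λ (j + 1))ᶜ ∩ s.Ω (j + 1)) (S (j + 1))) fun ω a hζ => ?_
    show W'.w j (s.Λ (j + 1)) ((s.Λ (j + 1))ᶜ ∩ s.Ω (j + 1)) (S (j + 1)) _ = W.w j (s.Λ (j + 1)) ((s.Λ (j + 1))ᶜ ∩ s.Ω (j + 1)) (S (j + 1)) _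
    rw [hw']
    refine Set.indicator_of_mem ?_ _
    -- the A-update of `ω` lies on the A-fibre of `ω`, where the row holds
    refine hdom j ω _ hζ (fun i hi => Function.update_of_ne hi _ _) (by rw [Function.update_self]; rfl) fun b hb => ?_
    rw [Function.update_self]
    show Function.updateFinset (ω j).2 _ a b = (ω j).2 b
    rw [Function.updateFinset_def]
    exact dif_neg fun h => hb ((Set.Finite.mem_toFinset _).mp h)
  rw [← heq]
  exact integrable_tkBranchOfRecord_baseCfg_of_dominated ν M g K W' s S hζm hζ0 hζ1 hwm' hw0' ŵ hŵm hdom' Cw hCw hΦm hΦ0 CΦ hΦle k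

end Support

/-! ## §3  ★★ Generic 12a″ weights: coercivity of `quad` ON THE SUPPORT OF `ζ0` ⇒ the §2 row, for EVERY branch `S` -/
section GenericZ

variable {F : T4Family} {N : ℕ} [NeZero N]
variable (ν : Stage7Numerics) (A₁ : ℝ) (p : B12.RunParams) (g : ℕ → ℝ)

/-- **★★ THE §2 ROW FROM COERCIVITY ON THE SUPPORT OF `ζ0`**, generic 12a″ weights `tkWeightsOfRecordP … Z` over ANY residual `Z`: if [I]'s form value
`Z.quad j Λ′` dominates `c·Σ_{b ∈ sA} ‖A_j(b)‖²` (`c > 0`) at every configuration `ω′` ON THE A-FIBRE (`sA = bondsIn j Y`) OF A CONFIGURATION `ω` WITH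
`Z.ζ0 j Y₀ ω ≠ 0` — and nowhere else — then for EVERY `S` the A-weight `w_j(Λ′, Y, S) = χ_A(Y, S)·e^{−½quad}` is dominated there by g0's Gaussian majorant
`ŵ(a) = Π_{b∈sA} e^{−c‖a b‖²∕2}` (measurable, finite product-Lebesgue mass), since `0 ≤ χ_A ≤ 1` (12a).  At 11a's generation arguments `Y₀ = Ω^c_{j+1}`,
`Λ′ = Λ_{j+1}`, `Y = Λᶜ_{j+1} ∩ Ω_{j+1}` this is §2's binder `hdom` at generation `j`. [cite: Balaban1988Convergent, (2.21) p.258, (3.21) p.269, (3.23) p.270; Balaban1987RG1, (2.11) p.267 (shape of the row)] -/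
theorem afibre_dominated_on_support_of_coercive_on_support (Z : TkResidualW F N (FluctV N) p.K) (j : ℕ)
    (Λ' Y₀ Y S : Set (Site (F.P p.K) 0)) {c : ℝ} (hc : 0 < c)
    (hcoer : ∀ ω ω' : MultiCfg (F.P p.K) (SU N) (FluctV N), Z.ζ0 j Y₀ ω ≠ 0 → (∀ i, i ≠ j → ω' i = ω i) → (ω' j).1 = (ω j).1 →
      (∀ b, b ∉ bondsIn j Y → (ω' j).2 b = (ω j).2 b) →
      c * ∑ b ∈ (Set.toFinite (bondsIn j Y)).toFinset, ‖(ω' j).2 b‖ ^ 2 ≤ Z.quad j Λ' ω') :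
    ∃ ŵ : (↥(Set.toFinite (bondsIn j Y)).toFinset → FluctV N) → ℝ≥0∞, Measurable ŵ ∧
      (∫⁻ a, ŵ a ∂(Measure.pi fun _ : ↥(Set.toFinite (bondsIn j Y)).toFinset => (volume : Measure (FluctV N)))) ≠ ⊤ ∧
      ∀ ω ω' : MultiCfg (F.P p.K) (SU N) (FluctV N), Z.ζ0 j Y₀ ω ≠ 0 → (∀ i, i ≠ j → ω' i = ω i) → (ω' j).1 = (ω j).1 →
        (∀ b, b ∉ bondsIn j Y → (ω' j).2 b = (ω j).2 b) →
        ENNReal.ofReal ((tkWeightsOfRecordP F N (FluctV N) ν A₁ p g Z).w j Λ' Y S ω') ≤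
          ŵ (fun b : ↥(Set.toFinite (bondsIn j Y)).toFinset => (ω' j).2 b) := by
  refine ⟨fun a => ∏ b, ENNReal.ofReal (Real.exp (-(c * ‖a b‖ ^ 2) / 2)), measurable_gaussMajorant c,
    lintegral_gaussMajorant_ne_top hc, fun ω ω' hζ h1 h2 h3 => ?_⟩
  have hχ1 := chiAW_le_one (F := F) (N := N) (V := FluctV N) (ν := ν) (A₁ := A₁) (p := p) (g := g) j Y S ω'
  have he := Real.exp_pos (-(1 / 2 : ℝ) * Z.quad j Λ' ω')
  show ENNReal.ofReal (chiAW F N (FluctV N) ν A₁ p g j Y S ω' * Real.exp (-(1 / 2 : ℝ) * Z.quad j Λ' ω')) ≤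
    ∏ b : ↥(Set.toFinite (bondsIn j Y)).toFinset, ENNReal.ofReal (Real.exp (-(c * ‖(ω' j).2 b‖ ^ 2) / 2))
  calc ENNReal.ofReal (chiAW F N (FluctV N) ν A₁ p g j Y S ω' * Real.exp (-(1 / 2 : ℝ) * Z.quad j Λ' ω'))
      ≤ ENNReal.ofReal (Real.exp (-(1 / 2 : ℝ) * Z.quad j Λ' ω')) := ENNReal.ofReal_le_ofReal (mul_le_of_le_one_left he.le hχ1)
    _ ≤ ENNReal.ofReal (∏ b ∈ (Set.toFinite (bondsIn j Y)).toFinset, Real.exp (-(c * ‖(ω' j).2 b‖ ^ 2) / 2)) :=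
        ENNReal.ofReal_le_ofReal (exp_neg_half_le_gaussMajorant _ (fun b => (ω' j).2 b) (hcoer ω ω' hζ h1 h2 h3))
    _ = ∏ b ∈ (Set.toFinite (bondsIn j Y)).toFinset, ENNReal.ofReal (Real.exp (-(c * ‖(ω' j).2 b‖ ^ 2) / 2)) :=
        ENNReal.ofReal_prod_of_nonneg fun b _ => (Real.exp_pos _).le
    _ = ∏ b : ↥(Set.toFinite (bondsIn j Y)).toFinset, ENNReal.ofReal (Real.exp (-(c * ‖(ω' j).2 b‖ ^ 2) / 2)) :=
        (Finset.prod_coe_sort _ _).symm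

/-- **★★ THE PRINT-SHAPED FACE — COERCIVITY AT REGULAR BACKGROUNDS**: let `Reg` be ANY predicate of the scale-`j` GAUGE component `(ω j).1` (the retained
variables the backgrounds read) such that a non-zero `ζ0_j(Y₀)` forces it — the consequent shape of node00-def-T's displayed law `TkResidualW.RegOn Γr` (12a″ §3,
p.256 «we assume that the field V_{j−1} is regular on Γ_{j−1}»).  If `Z.quad j Λ′` is coercive on the A-fibre at every `Reg` background, the §2 row follows for
every `S`: the A-insertion `ω[A_j|_{sA} := a]` keeps `(ω j).1`, so the guard is constant along every A-fibre. [cite: Balaban1988Convergent, (2.10) p.256, (2.21) p.258, (3.21) p.269; Balaban1987RG1, (2.11) p.267 (shape)] -/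
theorem afibre_dominated_on_support_of_coercive_on_regular (Z : TkResidualW F N (FluctV N) p.K) (j : ℕ)
    (Λ' Y₀ Y S : Set (Site (F.P p.K) 0)) (Reg : GaugeField (F.P p.K) j (SU N) → Prop) {c : ℝ} (hc : 0 < c)
    (hreg : ∀ ω : MultiCfg (F.P p.K) (SU N) (FluctV N), Z.ζ0 j Y₀ ω ≠ 0 → Reg (ω j).1)
    (hcoer : ∀ ω : MultiCfg (F.P p.K) (SU N) (FluctV N), Reg (ω j).1 →
      c * ∑ b ∈ (Set.toFinite (bondsIn j Y)).toFinset, ‖(ω j).2 b‖ ^ 2 ≤ Z.quad j Λ' ω) :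
    ∃ ŵ : (↥(Set.toFinite (bondsIn j Y)).toFinset → FluctV N) → ℝ≥0∞, Measurable ŵ ∧
      (∫⁻ a, ŵ a ∂(Measure.pi fun _ : ↥(Set.toFinite (bondsIn j Y)).toFinset => (volume : Measure (FluctV N)))) ≠ ⊤ ∧
      ∀ ω ω' : MultiCfg (F.P p.K) (SU N) (FluctV N), Z.ζ0 j Y₀ ω ≠ 0 → (∀ i, i ≠ j → ω' i = ω i) → (ω' j).1 = (ω j).1 →
        (∀ b, b ∉ bondsIn j Y → (ω' j).2 b = (ω j).2 b) →
        ENNReal.ofReal ((tkWeightsOfRecordP F N (FluctV N) ν A₁ p g Z).w j Λ' Y S ω') ≤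
          ŵ (fun b : ↥(Set.toFinite (bondsIn j Y)).toFinset => (ω' j).2 b) :=
  afibre_dominated_on_support_of_coercive_on_support ν A₁ p g Z j Λ' Y₀ Y S hc fun ω ω' hζ _ h2 _ =>
    hcoer ω' (by rw [h2]; exact hreg ω hζ)

end GenericZ

/-! ## §4  ★★★ At the v1.7 `CoPH` record, GENERIC `θ`: `hIB` for one old branch from coercivity ON THE SUPPORT OF `ζ0` -/
section Record

variable {F : T4Family} {N : ℕ} [NeZero N]
variable (θ : Stage13HParams F N) (p : B12.RunParams)

/-- **★★★ THE OLD BRANCH OF RECORD IS `dU_k`-INTEGRABLE FROM COERCIVITY OF THE RESIDUAL's `quad` ON THE SUPPORT OF `ζ0`**, generic `θ : Stage13HParams`,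
any history `s′` of length `k+1`, any branch `S`, any operand `Φ` of r11's shape — g0's `integrable_oldBranch_of_coercive` (p580601 §2 with the domination
binders discharged) with its row (ii′) WEAKENED: (i) residual rows — `zhLaws`, `ZhUnity`, measurability of `ζ0_j(Y)`∕`quad_j(Λ′)`; (ii″) COERCIVITY ON THE
SUPPORT — for each generation `j` a `c_j > 0` with `c_j·Σ_{b∈sA_j} ‖A_j(b)‖² ≤ quad_j(Λ_{j+1}(init s′))` at every configuration on the A-fibre of a
configuration where `ζ0_j((Ω_{j+1}(init s′))ᶜ) ≠ 0` ([I]'s positivity of `𝒬_j` WHERE PRINT HAS IT; displayed); (iii) `Φ` measurable with `0 ≤ Φ ≤ CΦ`.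
Then `U₀ ↦ 𝐓_k(init s′, S)[Φ](base_k U₀)` is integrable for product Haar (§2 at `W := WtOfRecord₁₃H θ p s′`, its row by §3).
[cite: Balaban1988Convergent, (2.18) p.257, (2.20)–(2.21) p.258, (3.16)–(3.21) pp.268–269, (3.23)–(3.24) p.270; Balaban1987RG1, (2.11) p.267 (shape of the row)] -/
theorem integrable_oldBranch_of_coercive_on_support
    (hZ : ∀ (p : B12.RunParams) (n : ℕ) (Ω Λ : ℕ → Set (Site (F.P p.K) 0)), (θ.Zh p n Ω Λ).Laws) (hU : θ.ZhUnity F N) {k : ℕ}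
    (s : SeqOfRecord F θ.ν θ.τ9.M (gOfRecord₁₃ F N θ.toStage13Params p) p.K (k + 1)) (S : ℕ → Set (Site (F.P p.K) 0))
    (hζm : ∀ j (Y : Set (Site (F.P p.K) 0)), Measurable ((θ.zhAt p s).ζ0 j Y))
    (hqm : ∀ j (Λ' : Set (Site (F.P p.K) 0)), Measurable ((θ.zhAt p s).quad j Λ'))
    (hcoer : ∀ j : ℕ, ∃ c : ℝ, 0 < c ∧ ∀ ω ω' : MultiCfg (F.P p.K) (SU N) (FluctV N),
      (θ.zhAt p s).ζ0 j (s.init.Ω (j + 1))ᶜ ω ≠ 0 → (∀ i, i ≠ j → ω' i = ω i) → (ω' j).1 = (ω j).1 →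
      (∀ b, b ∉ bondsIn j ((s.init.Λ (j + 1))ᶜ ∩ s.init.Ω (j + 1)) → (ω' j).2 b = (ω j).2 b) →
      c * ∑ b ∈ (Set.toFinite (bondsIn j ((s.init.Λ (j + 1))ᶜ ∩ s.init.Ω (j + 1)))).toFinset, ‖(ω' j).2 b‖ ^ 2 ≤
        (θ.zhAt p s).quad j (s.init.Λ (j + 1)) ω')
    {Φ : SFluct (F.P p.K) (FluctV N) → MSField (F.P p.K) (SU N) → ℝ}
    (hΦm : Measurable fun ω : MultiCfg (F.P p.K) (SU N) (FluctV N) => Φ (S, fun j => (ω j).2) (fun j => (ω j).1))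
    (hΦ0 : ∀ a U, 0 ≤ Φ a U) (CΦ : ℝ) (hΦle : ∀ a U, Φ a U ≤ CΦ) :
    Integrable (fun U₀ : GaugeField (F.P p.K) k (SU N) =>
      tkBranchOfRecord F N (FluctV N) θ.ν θ.τ9.M _ p.K (WtOfRecord₁₃H F N θ p s) s.init S k
        (fun ω => Φ (S, fun j => (ω j).2) (fun j => (ω j).1)) (baseCfg (V := FluctV N) k U₀)) (fieldMeasure (F.P p.K) k (SU N)) := by
  have hWlaws : (WtOfRecord₁₃H F N θ p s).Laws := WtOfRecord₁₃H_laws hZ p s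
  -- the rows of §3 at the history's weights, one `c_j` per generation
  have hrow : ∀ j : ℕ, ∃ ŵ : (↥(Set.toFinite (bondsIn j ((s.init.Λ (j + 1))ᶜ ∩ s.init.Ω (j + 1)))).toFinset → FluctV N) → ℝ≥0∞,
      Measurable ŵ ∧
      (∫⁻ a, ŵ a ∂(Measure.pi fun _ : ↥(Set.toFinite (bondsIn j ((s.init.Λ (j + 1))ᶜ ∩ s.init.Ω (j + 1)))).toFinset =>
        (volume : Measure (FluctV N)))) ≠ ⊤ ∧
      ∀ ω ω' : MultiCfg (F.P p.K) (SU N) (FluctV N), (θ.zhAt p s).ζ0 j (s.init.Ω (j + 1))ᶜ ω ≠ 0 → (∀ i, i ≠ j → ω' i = ω i) →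
        (ω' j).1 = (ω j).1 → (∀ b, b ∉ bondsIn j ((s.init.Λ (j + 1))ᶜ ∩ s.init.Ω (j + 1)) → (ω' j).2 b = (ω j).2 b) →
        ENNReal.ofReal ((WtOfRecord₁₃H F N θ p s).w j (s.init.Λ (j + 1)) ((s.init.Λ (j + 1))ᶜ ∩ s.init.Ω (j + 1)) (S (j + 1)) ω') ≤
          ŵ (fun b : ↥(Set.toFinite (bondsIn j ((s.init.Λ (j + 1))ᶜ ∩ s.init.Ω (j + 1)))).toFinset => (ω' j).2 b) := fun j => by
    obtain ⟨c, hc, h⟩ := hcoer j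
    exact afibre_dominated_on_support_of_coercive_on_support θ.ν θ.A₁ p (gOfRecord₁₃ F N θ.toStage13Params p) (θ.zhAt p s) j _ _ _ _ hc h
  choose ŵ hŵm hŵfin hdom using hrow
  refine integrable_tkBranchOfRecord_baseCfg_of_dominated_on_support θ.ν θ.τ9.M (gOfRecord₁₃ F N θ.toStage13Params p) p.K
    (WtOfRecord₁₃H F N θ p s) s.init S
    (fun j => measurable_WtOfRecord₁₃H_ζ θ p s j _ (hζm j _)) (fun j ω => hWlaws.zeta_nonneg j _ ω) (fun j ω => ?_)
    (fun j => measurable_WtOfRecord₁₃H_w θ p s j _ _ _ (hqm j _)) (fun j ω => TkWeights.w_nonneg hWlaws j _ _ _ ω) ŵ hŵm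
    (fun j ω ω' hζ => hdom j ω ω' hζ)
    (fun j => (∫⁻ a, ŵ j a ∂(Measure.pi fun _ : ↥(Set.toFinite (bondsIn j ((s.init.Λ (j + 1))ᶜ ∩ s.init.Ω (j + 1)))).toFinset =>
      (volume : Measure (FluctV N)))).toNNReal)
    (fun j => le_of_eq (ENNReal.coe_toNNReal (hŵfin j)).symm) hΦm (fun ω => hΦ0 _ _) CΦ (fun ω => hΦle _ _) k
  -- `ζ_j(Y) = ζ0_j(Y) ≤ 1`
  rw [WtOfRecord₁₃H_eq_tkWeightsOfRecordP, tkWeightsOfRecordP_ζ_apply]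
  exact zhAt_ζ0_le_one_of_unity θ p hZ hU s j _ ω

/-- **★★★ THE OLD BRANCH OF RECORD IS `dU_k`-INTEGRABLE FROM COERCIVITY AT REGULAR BACKGROUNDS** (the print-shaped face at the record): for predicates
`Reg_j` of the scale-`j` gauge component with `ζ0_j((Ω_{j+1}(init s′))ᶜ)(ω) ≠ 0 → Reg_j (ω j).1` (the consequent shape of def-T's displayed law `RegOn`) and
coercivity `c_j·Σ_{b∈sA_j} ‖A_j(b)‖² ≤ quad_j(Λ_{j+1}(init s′))` at every `Reg_j` background ([I]'s positivity of `𝒬_j` at regular backgrounds; displayed), the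
branch `U₀ ↦ 𝐓_k(init s′, S)[Φ](base_k U₀)` is integrable (rows (i), (iii) as in `integrable_oldBranch_of_coercive_on_support`).
[cite: Balaban1988Convergent, (2.10) p.256, (2.18) p.257, (2.20)–(2.21) p.258, (3.16)–(3.21) pp.268–269, (3.23)–(3.24) p.270; Balaban1987RG1, (2.11) p.267 (shape of the row)] -/
theorem integrable_oldBranch_of_coercive_on_regular
    (hZ : ∀ (p : B12.RunParams) (n : ℕ) (Ω Λ : ℕ → Set (Site (F.P p.K) 0)), (θ.Zh p n Ω Λ).Laws) (hU : θ.ZhUnity F N) {k : ℕ}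
    (s : SeqOfRecord F θ.ν θ.τ9.M (gOfRecord₁₃ F N θ.toStage13Params p) p.K (k + 1)) (S : ℕ → Set (Site (F.P p.K) 0))
    (hζm : ∀ j (Y : Set (Site (F.P p.K) 0)), Measurable ((θ.zhAt p s).ζ0 j Y))
    (hqm : ∀ j (Λ' : Set (Site (F.P p.K) 0)), Measurable ((θ.zhAt p s).quad j Λ'))
    (Reg : (j : ℕ) → GaugeField (F.P p.K) j (SU N) → Prop)
    (hreg : ∀ (j : ℕ) (ω : MultiCfg (F.P p.K) (SU N) (FluctV N)), (θ.zhAt p s).ζ0 j (s.init.Ω (j + 1))ᶜ ω ≠ 0 → Reg j (ω j).1)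
    (hcoer : ∀ j : ℕ, ∃ c : ℝ, 0 < c ∧ ∀ ω : MultiCfg (F.P p.K) (SU N) (FluctV N), Reg j (ω j).1 →
      c * ∑ b ∈ (Set.toFinite (bondsIn j ((s.init.Λ (j + 1))ᶜ ∩ s.init.Ω (j + 1)))).toFinset, ‖(ω j).2 b‖ ^ 2 ≤
        (θ.zhAt p s).quad j (s.init.Λ (j + 1)) ω)
    {Φ : SFluct (F.P p.K) (FluctV N) → MSField (F.P p.K) (SU N) → ℝ}
    (hΦm : Measurable fun ω : MultiCfg (F.P p.K) (SU N) (FluctV N) => Φ (S, fun j => (ω j).2) (fun j => (ω j).1))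
    (hΦ0 : ∀ a U, 0 ≤ Φ a U) (CΦ : ℝ) (hΦle : ∀ a U, Φ a U ≤ CΦ) :
    Integrable (fun U₀ : GaugeField (F.P p.K) k (SU N) =>
      tkBranchOfRecord F N (FluctV N) θ.ν θ.τ9.M _ p.K (WtOfRecord₁₃H F N θ p s) s.init S k
        (fun ω => Φ (S, fun j => (ω j).2) (fun j => (ω j).1)) (baseCfg (V := FluctV N) k U₀)) (fieldMeasure (F.P p.K) k (SU N)) :=
  integrable_oldBranch_of_coercive_on_support θ p hZ hU s S hζm hqm (fun j => by
    obtain ⟨c, hc, h⟩ := hcoer j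
    exact ⟨c, hc, fun ω ω' hζ _ h2 _ => h ω' (by rw [h2]; exact hreg j ω hζ)⟩) hΦm hΦ0 CΦ hΦle

/-- **★★★ … FED BY def-T's DISPLAYED LAW `RegOn Γr`**: if the residual serving the history obeys `TkResidualW.RegOn Γr` for a reading-region selector `Γr`
(«`ζ0_j(Y)(ω) ≠ 0` ⇒ `(ω j).1` is `(cR·ε_j)`-regular on the plaquettes of `T^{(j)}` touching `Γr j Y`», 12a″ §3 — print's selector is `readSelOfSeq Ω₀ Ω`:
`Λ₀` at `j = 0`, `Γ_j` for `1 ≤ j`), then coercivity of `quad_j(Λ_{j+1})` asked ONLY at backgrounds regular on the reading region `Γr j (Ω_{j+1})ᶜ` gives the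
integrability of the old branch.  This is the shape in which [I]'s positivity theorem for small background fields can be cited for the VALUE of `Zh.quad`
(node00-def-K0b) without any condition at irregular backgrounds. [cite: Balaban1988Convergent, (2.10) p.256, (2.2) p.255, (2.21) p.258, (3.23)–(3.24) p.270; Balaban1987RG1, (2.11) p.267 (shape of the row)] -/
theorem integrable_oldBranch_of_regOn_of_coercive_on_reading
    (hZ : ∀ (p : B12.RunParams) (n : ℕ) (Ω Λ : ℕ → Set (Site (F.P p.K) 0)), (θ.Zh p n Ω Λ).Laws) (hU : θ.ZhUnity F N) {k : ℕ}
    (s : SeqOfRecord F θ.ν θ.τ9.M (gOfRecord₁₃ F N θ.toStage13Params p) p.K (k + 1)) (S : ℕ → Set (Site (F.P p.K) 0))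
    (hζm : ∀ j (Y : Set (Site (F.P p.K) 0)), Measurable ((θ.zhAt p s).ζ0 j Y))
    (hqm : ∀ j (Λ' : Set (Site (F.P p.K) 0)), Measurable ((θ.zhAt p s).quad j Λ'))
    (cR : ℝ) (Γr : ℕ → Set (Site (F.P p.K) 0) → Set (Site (F.P p.K) 0))
    (hreg : (θ.zhAt p s).RegOn F N (FluctV N) θ.ν cR p (gOfRecord₁₃ F N θ.toStage13Params p) Γr)
    (hcoer : ∀ j : ℕ, ∃ c : ℝ, 0 < c ∧ ∀ ω : MultiCfg (F.P p.K) (SU N) (FluctV N),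
      PlaqSmallOn (plaqsOf (pts j (Γr j (s.init.Ω (j + 1))ᶜ))) (cR * epsOfRecord θ.ν (gOfRecord₁₃ F N θ.toStage13Params p) j) (ω j).1 →
      c * ∑ b ∈ (Set.toFinite (bondsIn j ((s.init.Λ (j + 1))ᶜ ∩ s.init.Ω (j + 1)))).toFinset, ‖(ω j).2 b‖ ^ 2 ≤
        (θ.zhAt p s).quad j (s.init.Λ (j + 1)) ω)
    {Φ : SFluct (F.P p.K) (FluctV N) → MSField (F.P p.K) (SU N) → ℝ}
    (hΦm : Measurable fun ω : MultiCfg (F.P p.K) (SU N) (FluctV N) => Φ (S, fun j => (ω j).2) (fun j => (ω j).1))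
    (hΦ0 : ∀ a U, 0 ≤ Φ a U) (CΦ : ℝ) (hΦle : ∀ a U, Φ a U ≤ CΦ) :
    Integrable (fun U₀ : GaugeField (F.P p.K) k (SU N) =>
      tkBranchOfRecord F N (FluctV N) θ.ν θ.τ9.M _ p.K (WtOfRecord₁₃H F N θ p s) s.init S k
        (fun ω => Φ (S, fun j => (ω j).2) (fun j => (ω j).1)) (baseCfg (V := FluctV N) k U₀)) (fieldMeasure (F.P p.K) k (SU N)) :=
  integrable_oldBranch_of_coercive_on_regular θ p hZ hU s S hζm hqm
    (fun j U => PlaqSmallOn (plaqsOf (pts j (Γr j (s.init.Ω (j + 1))ᶜ))) (cR * epsOfRecord θ.ν (gOfRecord₁₃ F N θ.toStage13Params p) j) U)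
    (fun j ω hζ => hreg j _ ω hζ) hcoer hΦm hΦ0 CΦ hΦle

end Record

/-! ## §5  The everywhere rows imply the refined rows (A2: every inhabitant of g0's row inhabits this file's) -/
section Transfer

variable {F : T4Family} {N : ℕ} [NeZero N] (θ : Stage13HParams F N) (p : B12.RunParams)

/-- **g0's EVERYWHERE COERCIVITY ROW IMPLIES §4's ROW** at the record: so every parameter meeting `integrable_oldBranch_of_coercive`'s row (ii′) — e.g.
dag-n11-w1's Gaussian-certificate class — meets (ii″), and g0 §4 is §4 ∘ this lemma. [cite: Balaban1988Convergent, (2.21) p.258 (bookkeeping)] -/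
theorem coercive_on_support_of_coercive {k : ℕ} (s : SeqOfRecord F θ.ν θ.τ9.M (gOfRecord₁₃ F N θ.toStage13Params p) p.K (k + 1))
    (hcoer : ∀ j : ℕ, ∃ c : ℝ, 0 < c ∧ ∀ ω : MultiCfg (F.P p.K) (SU N) (FluctV N),
      c * ∑ b ∈ (Set.toFinite (bondsIn j ((s.init.Λ (j + 1))ᶜ ∩ s.init.Ω (j + 1)))).toFinset, ‖(ω j).2 b‖ ^ 2 ≤
        (θ.zhAt p s).quad j (s.init.Λ (j + 1)) ω) :
    ∀ j : ℕ, ∃ c : ℝ, 0 < c ∧ ∀ ω ω' : MultiCfg (F.P p.K) (SU N) (FluctV N),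
      (θ.zhAt p s).ζ0 j (s.init.Ω (j + 1))ᶜ ω ≠ 0 → (∀ i, i ≠ j → ω' i = ω i) → (ω' j).1 = (ω j).1 →
      (∀ b, b ∉ bondsIn j ((s.init.Λ (j + 1))ᶜ ∩ s.init.Ω (j + 1)) → (ω' j).2 b = (ω j).2 b) →
      c * ∑ b ∈ (Set.toFinite (bondsIn j ((s.init.Λ (j + 1))ᶜ ∩ s.init.Ω (j + 1)))).toFinset, ‖(ω' j).2 b‖ ^ 2 ≤
        (θ.zhAt p s).quad j (s.init.Λ (j + 1)) ω' := fun j => by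
  obtain ⟨c, hc, h⟩ := hcoer j
  exact ⟨c, hc, fun _ ω' _ _ _ _ => h ω'⟩


/-- **BRIDGE — COERCIVITY AT `Reg`-BACKGROUNDS ⇒ THE SUPPORT-KEYED ROW** at the record (row level, per history): for predicates `Reg_j` of the scale-`j` gauge
component forced by a non-zero `ζ0_j((Ω_{j+1}(init s′))ᶜ)`, coercivity at every `Reg_j` background gives §4's row (ii″) — so every consumer keyed on (ii″) (this
seat's support-keyed spec ∕ 𝐓-step ∕ node-face editions) is fed from the print-shaped pair by this lemma. [cite: Balaban1988Convergent, (2.10) p.256, (2.21) p.258 (bookkeeping)] -/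
theorem coercive_on_support_of_coercive_on_regular {k : ℕ} (s : SeqOfRecord F θ.ν θ.τ9.M (gOfRecord₁₃ F N θ.toStage13Params p) p.K (k + 1))
    (Reg : (j : ℕ) → GaugeField (F.P p.K) j (SU N) → Prop)
    (hreg : ∀ (j : ℕ) (ω : MultiCfg (F.P p.K) (SU N) (FluctV N)), (θ.zhAt p s).ζ0 j (s.init.Ω (j + 1))ᶜ ω ≠ 0 → Reg j (ω j).1)
    (hcoer : ∀ j : ℕ, ∃ c : ℝ, 0 < c ∧ ∀ ω : MultiCfg (F.P p.K) (SU N) (FluctV N), Reg j (ω j).1 →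
      c * ∑ b ∈ (Set.toFinite (bondsIn j ((s.init.Λ (j + 1))ᶜ ∩ s.init.Ω (j + 1)))).toFinset, ‖(ω j).2 b‖ ^ 2 ≤
        (θ.zhAt p s).quad j (s.init.Λ (j + 1)) ω) :
    ∀ j : ℕ, ∃ c : ℝ, 0 < c ∧ ∀ ω ω' : MultiCfg (F.P p.K) (SU N) (FluctV N),
      (θ.zhAt p s).ζ0 j (s.init.Ω (j + 1))ᶜ ω ≠ 0 → (∀ i, i ≠ j → ω' i = ω i) → (ω' j).1 = (ω j).1 →
      (∀ b, b ∉ bondsIn j ((s.init.Λ (j + 1))ᶜ ∩ s.init.Ω (j + 1)) → (ω' j).2 b = (ω j).2 b) →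
      c * ∑ b ∈ (Set.toFinite (bondsIn j ((s.init.Λ (j + 1))ᶜ ∩ s.init.Ω (j + 1)))).toFinset, ‖(ω' j).2 b‖ ^ 2 ≤
        (θ.zhAt p s).quad j (s.init.Λ (j + 1)) ω' := fun j => by
  obtain ⟨c, hc, h⟩ := hcoer j
  exact ⟨c, hc, fun ω ω' hζ _ h2 _ => h ω' (by rw [h2]; exact hreg j ω hζ)⟩

/-- **BRIDGE — def-T's `RegOn Γr` + COERCIVITY AT READING-REGULAR BACKGROUNDS ⇒ THE SUPPORT-KEYED ROW** (row level, per history): the print-shaped pair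
«`(θ.zhAt p s′).RegOn Γr`» + «`quad_j(Λ_{j+1}(init s′))` coercive at every background `(cR·ε_j)`-regular on `Γr j (Ω_{j+1}(init s′))ᶜ`» gives §4's row (ii″).
[cite: Balaban1988Convergent, (2.10) p.256, (2.2) p.255, (2.21) p.258 (bookkeeping)] -/
theorem coercive_on_support_of_regOn_of_coercive_on_reading {k : ℕ} (s : SeqOfRecord F θ.ν θ.τ9.M (gOfRecord₁₃ F N θ.toStage13Params p) p.K (k + 1))
    (cR : ℝ) (Γr : ℕ → Set (Site (F.P p.K) 0) → Set (Site (F.P p.K) 0))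
    (hreg : (θ.zhAt p s).RegOn F N (FluctV N) θ.ν cR p (gOfRecord₁₃ F N θ.toStage13Params p) Γr)
    (hcoer : ∀ j : ℕ, ∃ c : ℝ, 0 < c ∧ ∀ ω : MultiCfg (F.P p.K) (SU N) (FluctV N),
      PlaqSmallOn (plaqsOf (pts j (Γr j (s.init.Ω (j + 1))ᶜ))) (cR * epsOfRecord θ.ν (gOfRecord₁₃ F N θ.toStage13Params p) j) (ω j).1 →
      c * ∑ b ∈ (Set.toFinite (bondsIn j ((s.init.Λ (j + 1))ᶜ ∩ s.init.Ω (j + 1)))).toFinset, ‖(ω j).2 b‖ ^ 2 ≤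
        (θ.zhAt p s).quad j (s.init.Λ (j + 1)) ω) :
    ∀ j : ℕ, ∃ c : ℝ, 0 < c ∧ ∀ ω ω' : MultiCfg (F.P p.K) (SU N) (FluctV N),
      (θ.zhAt p s).ζ0 j (s.init.Ω (j + 1))ᶜ ω ≠ 0 → (∀ i, i ≠ j → ω' i = ω i) → (ω' j).1 = (ω j).1 →
      (∀ b, b ∉ bondsIn j ((s.init.Λ (j + 1))ᶜ ∩ s.init.Ω (j + 1)) → (ω' j).2 b = (ω j).2 b) →
      c * ∑ b ∈ (Set.toFinite (bondsIn j ((s.init.Λ (j + 1))ᶜ ∩ s.init.Ω (j + 1)))).toFinset, ‖(ω' j).2 b‖ ^ 2 ≤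
        (θ.zhAt p s).quad j (s.init.Λ (j + 1)) ω' :=
  coercive_on_support_of_coercive_on_regular θ p s
    (fun j U => PlaqSmallOn (plaqsOf (pts j (Γr j (s.init.Ω (j + 1))ᶜ))) (cR * epsOfRecord θ.ν (gOfRecord₁₃ F N θ.toStage13Params p) j) U)
    (fun j ω hζ => hreg j _ ω hζ) hcoer

end Transfer

end Summit.QuantumFields.YangMills.Theorems.BalabanUVNodesN11AFibreDominationOnSupport

end
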